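import Mathlib

/-!
# R26 — 𝔾ₘ-NOSES: the polar Euclid words and certificate C1, kernel-checked bookkeeping
(companion of `R26-GM-NOSES.md`, card `Ideas/toric-towers.md` ROUND 26)

[OURS · L W4.5b · IDEATOR 1 (res-L1-w45b-idea-1) g35 · 2026-08-29]  AI-written; nothing is attributed to [Hironaka2017];
EL♮(3) is NOT proved; counted 0.  Exact integer bookkeeping only (`decide`); no algebraic geometry of the route is formalised here.

A 𝔾ₘ-surface `H = V(F) ⊂ ℙ³`, `F` semi-invariant for `diag(t^{w_x}, t^{w_y}, t^{w_z}, t^{w_w})`, has a finite support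
`Π ⊂ ℤ⁴`; we record exponents `(a,b,c)` (the `w`-exponent dropped: the support function is shift-invariant) and rays of the fan of
`ℙ³` in `N = ℤ⁴/ℤ(1,1,1,1) ≅ ℤ³` with `e_x=(1,0,0), e_y=(0,1,0), e_z=(0,0,1), e_w=(-1,-1,-1)`; the one-parameter subgroup is the
lattice point `w = (w_x-w_w, w_y-w_w, w_z-w_w)`.
* `h Π r = min_{m∈Π} ⟨r,m⟩` (order of `F` along the toric divisor `D_r`), `ord Π τ = min_m Σ_{ρ∈τ} (⟨ρ,m⟩ - h ρ)` = order of the strict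
  transform along the orbit `O(τ)`: `ord ≥ 1` ⟺ `O(τ) ⊂ H′` (an E1-LEGAL toric centre), `ord ≥ 2` ⟹ `O(τ) ⊂ Sing H′`.
* `legal2 Π F word`: every starred face is a face of the current fan with `ord ≥ 2`; `regularFan`: all maximal cones unimodular.
* `certC1' Π w F` / `condFaces` (ROUND 27, R27-0; crit-3 g11 rider R-C1): clause (c′) — ord-0 2-faces outside every polar cone
  have `Δ^τ` a vertex or a primitive binomial edge, else they are listed as CONDITIONAL (C234: the two faces through `e_y`; D124: through `e_x`).
* `certC1 Π w F` (memo §2, Lemma C1): every face `τ` of a maximal cone with `±w ∉ τ` has `ord τ ≤ 1`, and no such 2-face with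
  `ord = 1` has `w ∈ span τ`; `certEdges`: every ray outside the polar cones has face `Δ^ρ` a vertex or a primitive binomial edge.
Theorems (all `decide`): the words of the memo's Table 1 for the families A345 (`w=(3,4,5,0)`, sextics), B235, C234, D124 and the
quartic pencil are `legal2`, end in regular fans of the stated sizes with `±w` rays, and satisfy `certC1 ∧ certEdges`.
-/

set_option linter.dupNamespace false -- mandated namespace `Summit.<Summit>.<Problem>` of this single-conjunct summit

namespace Summit.ResolutionOfSingularities.ResolutionOfSingularities.Cruxes.EquisingularLiftNatThree.ToricTowers.R26

abbrev Ray := ℤ × ℤ × ℤ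

def dot (r m : Ray) : ℤ := r.1 * m.1 + r.2.1 * m.2.1 + r.2.2 * m.2.2

def lmin : List ℤ → ℤ
  | [] => 0
  | x :: xs => xs.foldr min x

/-- support function `h Π r = min_{m ∈ Π} ⟨r, m⟩`. -/
def h (V : List Ray) (r : Ray) : ℤ := lmin (V.map (dot r))

def excess (V : List Ray) (c : List Ray) (m : Ray) : ℤ := (c.map fun r => dot r m - h V r).sum

/-- order of the strict transform along the orbit of the cone spanned by `c`. -/
def ord (V : List Ray) (c : List Ray) : ℤ := lmin (V.map (excess V c))

def det3 : List Ray → ℤ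
  | [a, b, d] => a.1 * (b.2.1 * d.2.2 - b.2.2 * d.2.1) - a.2.1 * (b.1 * d.2.2 - b.2.2 * d.1) + a.2.2 * (b.1 * d.2.1 - b.2.1 * d.1)
  | _ => 0

def regularFan (F : List (List Ray)) : Bool := F.all fun c => (det3 c).natAbs == 1

def vsum (c : List Ray) : Ray := c.foldl (fun s r => (s.1 + r.1, s.2.1 + r.2.1, s.2.2 + r.2.2)) (0, 0, 0)
def isSub (τ c : List Ray) : Bool := τ.all fun t => c.contains t

/-- regular (barycentric) star subdivision of the fan `F` at the face `τ`. -/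
def star (F : List (List Ray)) (τ : List Ray) : List (List Ray) :=
  F.foldr (fun c acc => if isSub τ c then (τ.map fun t => (c.filter fun r => r != t) ++ [vsum τ]) ++ acc else c :: acc) []

def play (F : List (List Ray)) : List (List Ray) → List (List Ray)
  | [] => F
  | τ :: ws => play (star F τ) ws

/-- every face of the word is a face of the current fan with `ord ≥ 2` (centre inside the singular locus of the strict transform;
in particular E1-legal, `ord ≥ 1`). -/
def legal2 (V : List Ray) (F : List (List Ray)) : List (List Ray) → Bool
  | [] => true
  | τ :: ws => (decide (2 ≤ ord V τ) && F.any (isSub τ)) && legal2 V (star F τ) ws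

def neg (w : Ray) : Ray := (-w.1, -w.2.1, -w.2.2)
def polar (w : Ray) (c : List Ray) : Bool := c.contains w || c.contains (neg w)

def faces : List Ray → List (List Ray)
  | [a, b, d] => [[a, b], [a, d], [b, d], [a, b, d]]
  | _ => []

/-- certificate C1 on the non-polar faces (memo Lemma C1 (a),(b)). -/
def certC1 (V : List Ray) (w : Ray) (F : List (List Ray)) : Bool :=
  F.all fun c => polar w c ||
    (faces c).all fun τ => decide (ord V τ ≤ 1) && (τ.length != 2 || !(ord V τ == 1 && det3 (τ ++ [w]) == 0))

def minimisers (V : List Ray) (r : Ray) : List Ray := V.filter fun m => dot r m == h V r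
def gcd3 (m : Ray) : ℕ := Nat.gcd (Nat.gcd m.1.natAbs m.2.1.natAbs) m.2.2.natAbs

/-- `Δ^ρ` is a vertex, or an edge carrying exactly two support points at primitive distance (a binomial with simple zeros). -/
def edgeOK (V : List Ray) (r : Ray) : Bool :=
  match minimisers V r with
  | [_] => true
  | [m, m'] => gcd3 (m.1 - m'.1, m.2.1 - m'.2.1, m.2.2 - m'.2.2) == 1
  | _ => false

def rays (F : List (List Ray)) : List Ray := F.flatten.eraseDups
def inPolar (w : Ray) (F : List (List Ray)) (r : Ray) : Bool := F.any fun c => polar w c && c.contains r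

/-- certificate C1 (c): rays outside every polar cone have vertex / primitive-binomial faces. -/
def certEdges (V : List Ray) (w : Ray) (F : List (List Ray)) : Bool := (rays F).all fun r => inPolar w F r || edgeOK V r

def hasRay (F : List (List Ray)) (r : Ray) : Bool := F.any fun c => c.contains r

def ex : Ray := (1, 0, 0)
def ey : Ray := (0, 1, 0)
def ez : Ray := (0, 0, 1)
def ew : Ray := (-1, -1, -1)
/-- the fan of `ℙ³`. -/
def P3 : List (List Ray) := [[ex, ey, ez], [ex, ey, ew], [ex, ez, ew], [ey, ez, ew]]

/-! ## Family A345: `w = (3,4,5,0)`, sextics on `M(6,20) = {z⁴w², y⁵w, xy³zw, x²yz²w, x⁴y², x⁵z}`; `Z = cl{[t³:t⁴:t⁵:1]}` has the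
non-planar monomial space cusp `⟨3,4,5⟩` at the source `[0:0:0:1]` (species Σ6). -/

def suppA : List Ray := [(0, 0, 4), (0, 5, 0), (1, 3, 1), (2, 1, 2), (4, 2, 0), (5, 0, 1)]
def wA : Ray := (3, 4, 5)
/-- the polar Euclid word (follow `+w`: 3 points + 1 curve; follow `−w`: 2 points + 3 curves) and one phase-2 curve. -/
def wordA : List (List Ray) :=
  [[ex, ey, ez], [(1, 1, 1), ey, ez], [(1, 1, 1), (1, 2, 2), ez], [(1, 1, 1), (2, 3, 4)],
   [ew, ex, ey], [(0, 0, -1), ew, ex], [(0, -1, -2), ew], [(-1, -2, -3), ew], [(-2, -3, -4), ew], [(0, 0, -1), ew]]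

theorem A345_word_legal : legal2 suppA P3 wordA = true := by decide
theorem A345_fan_regular : regularFan (play P3 wordA) = true ∧ (play P3 wordA).length = 24 ∧
    hasRay (play P3 wordA) wA = true ∧ hasRay (play P3 wordA) (neg wA) = true := by decide
theorem A345_certificate : certC1 suppA wA (play P3 wordA) = true ∧ certEdges suppA wA (play P3 wordA) = true := by decide
/-- the source is a point of order 4 > 2 = the order along `Z` (not equimultiple: blowing up `Z` first is not even available). -/
theorem A345_source_order : ord suppA [ex, ey, ez] = 4 ∧ ord suppA [ew, ex, ey] = 2 := by decide

/-- in characteristic 2 the certified vector `c₁ = (1,−1,1,−2,2,−1)` has the 4-term support below; the same word stays legal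
(kit j327749 certifies the end state for that reduced polynomial). -/
def suppA2 : List Ray := [(0, 0, 4), (0, 5, 0), (1, 3, 1), (5, 0, 1)]
theorem A345_word_legal_mod2 : legal2 suppA2 P3 wordA = true := by decide

/-! ## Family B235: `w = (2,3,5,0)`, sextics on `M(6,15)`. -/
def suppB : List Ray := [(0, 0, 3), (0, 5, 0), (1, 1, 2), (2, 2, 1), (3, 3, 0), (5, 0, 1)]
def wB : Ray := (2, 3, 5)
def wordB : List (List Ray) :=
  [[ex, ey, ez], [(1, 1, 1), ey, ez], [(1, 1, 1), (1, 2, 2), ez], [(2, 3, 4), ez],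
   [ew, ex, ey], [(0, 0, -1), ew, ex], [(0, -1, -2), (0, 0, -1), ew], [(-1, -2, -4), ew],
   [(0, -1, -2), ew], [(0, 0, -1), ew], [(1, 1, 1), ez], [(1, 2, 2), ez]]
theorem B235_word_legal : legal2 suppB P3 wordB = true := by decide
/-- characteristic 2, vector `c₁ = (1,−1,−2,2,1,−1)`: 4-term support, word still legal. -/
def suppB2 : List Ray := [(0, 0, 3), (0, 5, 0), (3, 3, 0), (5, 0, 1)]
theorem B235_word_legal_mod2 : legal2 suppB2 P3 wordB = true := by decide
theorem B235_fan_regular : regularFan (play P3 wordB) = true ∧ (play P3 wordB).length = 28 ∧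
    hasRay (play P3 wordB) wB = true ∧ hasRay (play P3 wordB) (neg wB) = true := by decide
theorem B235_certificate : certC1 suppB wB (play P3 wordB) = true ∧ certEdges suppB wB (play P3 wordB) = true := by decide

/-! ## Family C234: `w = (2,3,4,0)`, quintics on `M(5,12)` (one conditional edge at `e_y`: three support points; squarefree for
the certified coefficient vectors, kit j327749). -/
def suppC : List Ray := [(0, 0, 3), (0, 4, 0), (1, 2, 1), (2, 0, 2), (3, 2, 0), (4, 0, 1)]
def wC : Ray := (2, 3, 4)
def wordC : List (List Ray) :=
  [[ex, ey, ez], [(1, 1, 1), ey, ez], [(1, 1, 1), (1, 2, 2), ez], [ew, ex, ey], [(0, 0, -1), ew, ex],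
   [(0, -1, -2), ew], [(-1, -2, -3), ew], [(0, 0, -1), ew]]
theorem C234_word_legal : legal2 suppC P3 wordC = true := by decide
theorem C234_fan_regular : regularFan (play P3 wordC) = true ∧ (play P3 wordC).length = 20 ∧
    hasRay (play P3 wordC) wC = true ∧ hasRay (play P3 wordC) (neg wC) = true := by decide
theorem C234_certificate : certC1 suppC wC (play P3 wordC) = true ∧
    ((rays (play P3 wordC)).filter fun r => !(inPolar wC (play P3 wordC) r || edgeOK suppC r)) = [ey] := by decide

/-! ## Family D124: `w = (1,2,4,0)`, quintics on `M(5,8)` (one conditional edge at `e_x`). -/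
def suppD : List Ray := [(0, 0, 2), (0, 2, 1), (0, 4, 0), (2, 1, 1), (2, 3, 0), (4, 0, 1)]
def wD : Ray := (1, 2, 4)
def wordD : List (List Ray) :=
  [[ex, ey, ez], [(1, 1, 1), ey, ez], [(1, 2, 2), ez], [(1, 2, 3), ez], [ew, ex, ey], [(0, 0, -1), ew, ex],
   [(0, -1, -2), (0, 0, -1), ew], [(1, 1, 1), ez]]
theorem D124_word_legal : legal2 suppD P3 wordD = true := by decide
theorem D124_fan_regular : regularFan (play P3 wordD) = true ∧ (play P3 wordD).length = 20 ∧
    hasRay (play P3 wordD) wD = true ∧ hasRay (play P3 wordD) (neg wD) = true := by decide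
theorem D124_certificate : certC1 suppD wD (play P3 wordD) = true ∧
    ((rays (play P3 wordD)).filter fun r => !(inPolar wD (play P3 wordD) r || edgeOK suppD r)) = [ex] := by decide

/-! ## The quartic pencil `μ(x²−yw)(y²−xz) + ν(xy−zw)²` (twisted cubic, `w = (1,2,3,0)`): the polar words alone certify; but here
ONE blow-up of `Z` already resolves (memo §7, kit j327749 PART A) — an `Unobs` customer, recorded for comparison only. -/
def suppP : List Ray := [(0, 0, 2), (0, 3, 0), (1, 1, 1), (2, 2, 0), (3, 0, 1)]
def wP : Ray := (1, 2, 3)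
def wordP : List (List Ray) :=
  [[ex, ey, ez], [(1, 1, 1), ey, ez], [(1, 2, 2), ez], [ew, ex, ey], [(0, 0, -1), ew, ex], [(0, -1, -2), ew]]
theorem pencil_word_legal : legal2 suppP P3 wordP = true := by decide
theorem pencil_certificate : regularFan (play P3 wordP) = true ∧ (play P3 wordP).length = 16 ∧
    certC1 suppP wP (play P3 wordP) = true ∧ certEdges suppP wP (play P3 wordP) = true := by decide

/-! ## A bipolar fan is unreachable (memo §2 remark): after the polar words of the pencil, four non-polar maximal cones are
`h`-linear (`ord = 0`), hence can never be legally subdivided. -/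
theorem pencil_linear_nonpolar_cones :
    ((play P3 wordP).filter fun c => !polar wP c && ord suppP c == 0).length = 4 := by decide

/-! ## Clause (c′) of certificate C1 (crit-3 g11 RIDER R-C1 / SHARPEN S-R26-1, STATUS l.86578, taken in ROUND 27, R27-0; memo R27 §8).
Lemma C1's sentence «2-cones: ord 0 ⟹ O(τ) ∩ H′ = ∅» is false as written: `ord τ = 0` gives only `O(τ) ⊄ H′`, and
`O(τ) ∩ H′` is the zero set of the `Δ^τ`-binomial/polynomial (`Δ^τ` = the common minimisers of the two rays of `τ`).  The sharpened
certificate asks, for every ord-0 2-face `τ ∌ ±w` lying in NO polar cone, that `Δ^τ` be a vertex or a primitive binomial edge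
(`faceOK`); a face failing this is a CONDITIONAL edge (squarefreeness of the `Δ^τ`-polynomial to be checked by hand, as in (c)).
Outcome (all `decide`): `certC1'` holds outright for A345, B235 and the pencil; for C234 / D124 the failing faces are exactly the two
2-faces through `e_y` / `e_x`, whose common 3-point `Δ^τ` is the conditional edge of Table 1 (certified squarefree there). -/

def faceMinimisers (V : List Ray) (τ : List Ray) : List Ray := V.filter fun m => τ.all fun r => dot r m == h V r

/-- `Δ^τ` is a vertex, or an edge carrying exactly two support points at primitive distance. -/
def faceOK (V : List Ray) (τ : List Ray) : Bool :=
  match faceMinimisers V τ with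
  | [_] => true
  | [m, m'] => gcd3 (m.1 - m'.1, m.2.1 - m'.2.1, m.2.2 - m'.2.2) == 1
  | _ => false

def inPolarFace (w : Ray) (F : List (List Ray)) (τ : List Ray) : Bool := F.any fun c => polar w c && isSub τ c

/-- certificate C1 (c′): every ord-0 2-face `τ ∌ ±w` of a maximal cone that lies in no polar cone has `faceOK`. -/
def certC1' (V : List Ray) (w : Ray) (F : List (List Ray)) : Bool :=
  F.all fun c => (faces c).all fun τ =>
    τ.length != 2 || polar w τ || !(ord V τ == 0) || inPolarFace w F τ || faceOK V τ

/-- the CONDITIONAL 2-faces: ord-0, `±w ∉ τ`, in no polar cone, `Δ^τ` neither a vertex nor a primitive binomial edge. -/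
def condFaces (V : List Ray) (w : Ray) (F : List (List Ray)) : List (List Ray) :=
  ((F.flatMap faces).filter fun τ =>
    τ.length == 2 && !polar w τ && ord V τ == 0 && !inPolarFace w F τ && !faceOK V τ).eraseDups

def C234COND : List (List Ray) := [[ey, (1, 2, 2)], [ey, (-1, -1, -2)]]
/-- `{z³w², x²z²w, x⁴z}` in the coordinates of `suppC`. -/
def C234DELTA : List Ray := [(0, 0, 3), (2, 0, 2), (4, 0, 1)]
def D124COND : List (List Ray) := [[ex, (1, 1, 2)], [ex, (0, -1, -2)]]
/-- `{z²w³, y²zw², y⁴w}` in the coordinates of `suppD`. -/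
def D124DELTA : List Ray := [(0, 0, 2), (0, 2, 1), (0, 4, 0)]

theorem A345_certificate' : certC1' suppA wA (play P3 wordA) = true := by decide
theorem B235_certificate' : certC1' suppB wB (play P3 wordB) = true := by decide
theorem pencil_certificate' : certC1' suppP wP (play P3 wordP) = true := by decide
/-- C234: `certC1'` fails exactly at the two faces through `e_y`, with the common `Δ^τ` of Table 1's conditional edge. -/
theorem C234_condFaces : certC1' suppC wC (play P3 wordC) = false ∧ condFaces suppC wC (play P3 wordC) = C234COND ∧
    (C234COND.map (faceMinimisers suppC)).eraseDups = [C234DELTA] := by decide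
/-- D124: `certC1'` fails exactly at the two faces through `e_x`, with the common `Δ^τ` of Table 1's conditional edge. -/
theorem D124_condFaces : certC1' suppD wD (play P3 wordD) = false ∧ condFaces suppD wD (play P3 wordD) = D124COND ∧
    (D124COND.map (faceMinimisers suppD)).eraseDups = [D124DELTA] := by decide

end Summit.ResolutionOfSingularities.ResolutionOfSingularities.Cruxes.EquisingularLiftNatThree.ToricTowers.R26
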